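import Summits.PneNP.PneNP.Theorems.ChebyshevTracialDesignTiltedSmallBlockTools
import HarnessLib

/-!
# Cell pnp-psdrank, route `ChebyshevTracialDesign`: TILTED SMALL BLOCKS — the per-level and level-sum expansions (brick 151b;
# crux `TracialDecayExp20`, stmt-PneNP-19878)

Brick 151b (prover g30; MEMO-33 §1). Continuation of brick 151a (`…TiltedSmallBlockTools`). For a `π`-stable ground set `S`, a
block `H`, a mask `ψ` and crossing-plane data `(λ, κ, L)`:

* §5 **`avg_tilted_expand`** — the shell average `E_{Shell_S(t',c')}[ψ(X)(2λ(X−Y)+L−κc)²]` expanded into the seven pieces of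
  brick 151a §1 with the half-count / half-pair pieces HALF-PINNED (151a §3): three plain averages on `S`, two one-vertex-pinned
  averages on `S∖e_v` (level `c'−1`, factor `c'/|S|`), one two-vertex-pinned average on `S∖e_v∖e_w` (level `c'−2`, factor
  `c'(c'−1)/(|S|(|S|−2))`); `sum_regroup7` (pure algebra).
* §6 **`levelSum_tilted_expand`** — the same summed against a rule `(C, w)` with a polynomial level weight `p` vanishing on the
  levels `c < g` (reduced level `c − g`): seven polynomially weighted level sums with weights `p`, `pX`, `pX²`, `p(X−g)`,
  `pX(X−g)`, `p(X−g)`, `p(X−g)(X−g−1)`.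
* §7 small tools for the assembly (brick 151): `card_inter_mul_pred_le`, `abs_div_mul_sum_le`, `abs_div_mul_sum_sum_le`,
  `weights_natDegree_le`, `weights_abs_eval_le`.
WHAT THIS FILE DOES NOT DO: the pricing (brick 151), the class split on `[n]` (152), the `M`-average (153); anything on
`TracialDecayExp20` itself, psd rank of P_PM(K_n), or P vs NP. [cite: Rothvoss2017, §2 (PDF p. 6)]
[cite: Agarwal2000DifferenceEquations, Remark 1.8.1 (1.8.8)]
Stature: support/instrument (kernel lane, no defs, axioms standard). Supports stmt-PneNP-19878.
-/

set_option linter.dupNamespace false -- `Summit.PneNP.PneNP.…`: summit = sub-problem (D-0017)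

noncomputable section

namespace Summit.PneNP.PneNP.Theorems.ChebyshevTracialDesignTiltedSmallBlockExpansion

open Finset Polynomial Literature.Barriers.PneNP Literature.Combinatorics.Optimization
open Literature.Combinatorics.Optimization.ShellStep
open Summit.PneNP.PneNP.Theorems.ChebyshevTracialDesignTiltedSmallBlockTools

variable {n : ℕ}

/-! ### §5 The per-level expansion of the tilted average -/

/-- Regrouping a level sum of seven pieces (pure algebra). [cite: Rothvoss2017, §2 (PDF p. 6)] -/
theorem sum_regroup7 {ι κ : Type*} (C : Finset ι) (V : Finset κ) (Wv : κ → Finset κ) (A B D : ι → ℝ)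
    (E F G : κ → ι → ℝ) (J : κ → κ → ι → ℝ) (k₁ k₂ k₃ k₄ k₅ k₆ : ℝ) :
    ∑ c ∈ C, (A c - k₁ * B c + k₂ * D c - k₃ * ∑ v ∈ V, E v c + k₄ * ∑ v ∈ V, F v c + k₅ * ∑ v ∈ V, G v c
        + k₆ * ∑ v ∈ V, ∑ w ∈ Wv v, J v w c) =
      ∑ c ∈ C, A c - k₁ * ∑ c ∈ C, B c + k₂ * ∑ c ∈ C, D c - k₃ * ∑ v ∈ V, ∑ c ∈ C, E v c
        + k₄ * ∑ v ∈ V, ∑ c ∈ C, F v c + k₅ * ∑ v ∈ V, ∑ c ∈ C, G v c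
        + k₆ * ∑ v ∈ V, ∑ w ∈ Wv v, ∑ c ∈ C, J v w c := by
  have h3 : ∑ c ∈ C, ∑ v ∈ V, E v c = ∑ v ∈ V, ∑ c ∈ C, E v c := Finset.sum_comm
  have h4 : ∑ c ∈ C, ∑ v ∈ V, F v c = ∑ v ∈ V, ∑ c ∈ C, F v c := Finset.sum_comm
  have h5 : ∑ c ∈ C, ∑ v ∈ V, G v c = ∑ v ∈ V, ∑ c ∈ C, G v c := Finset.sum_comm
  have h6 : ∑ c ∈ C, ∑ v ∈ V, ∑ w ∈ Wv v, J v w c = ∑ v ∈ V, ∑ w ∈ Wv v, ∑ c ∈ C, J v w c := by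
    rw [Finset.sum_comm]
    exact sum_congr rfl fun v _ => Finset.sum_comm
  simp only [sum_add_distrib, sum_sub_distrib, ← mul_sum, h3, h4, h5, h6]

section Expand

variable {π : Fin n → Fin n} (hπ : ∀ v, π (π v) = v) (hπ' : ∀ v, π v ≠ v)
include hπ hπ'

/-- **The tilted shell average, expanded and half-pinned** (every level `c'`; the shell nonempty when `c' ≥ 1`; `t' ≥ 2`):
`E_{Shell_S(t',c')}[ψ(X)(2λ(X−Y)+L−κ·c)²] = E[ψ₀] − 2κc·E[ψ₁] + κ²c²·E[ψ] − 4λ(c'/|S|)Σ_v E_v[ψ₁(·+1)]`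
`+ (4λκc + 4λ²)(c'/|S|)Σ_v E_v[ψ(·+1)] + 4λ²(c'(c'−1)/(|S|(|S|−2)))Σ_vΣ_w E_{vw}[ψ(·+2)]`
(`E_v` over `Shell_{S∖e_v}(t'−1,c'−1)`, `E_{vw}` over `Shell_{S∖e_v∖e_w}(t'−2,c'−2)`). [cite: Rothvoss2017, §2 (PDF p. 6)] -/
theorem avg_tilted_expand {S : Finset (Fin n)} (hS : ∀ u ∈ S, π u ∈ S) (H : Finset (Fin n)) {t' : ℕ} (ht' : 2 ≤ t')
    (c' : ℕ) (hne : 1 ≤ c' → (shellIn π S t' c').Nonempty) (ψ : ℤ → ℝ) (lam kap L cR : ℝ) :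
    (∑ U ∈ shellIn π S t' c', ψ ((U ∩ H).card : ℤ) *
        (2 * lam * (((U ∩ H).card : ℝ) - ((half π U ∩ H).card : ℝ)) + L - kap * cR) ^ 2) /
        ((shellIn π S t' c').card : ℝ) =
      (∑ U ∈ shellIn π S t' c', (fun x : ℤ => ψ x * (2 * lam * (x : ℝ) + L) ^ 2) ((U ∩ H).card : ℤ)) /
          ((shellIn π S t' c').card : ℝ)
      - 2 * kap * cR * ((∑ U ∈ shellIn π S t' c', (fun x : ℤ => ψ x * (2 * lam * (x : ℝ) + L)) ((U ∩ H).card : ℤ)) /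
          ((shellIn π S t' c').card : ℝ))
      + kap ^ 2 * cR ^ 2 * ((∑ U ∈ shellIn π S t' c', ψ ((U ∩ H).card : ℤ)) / ((shellIn π S t' c').card : ℝ))
      - 4 * lam * (((c' : ℝ) / (S.card : ℝ)) * ∑ v ∈ S ∩ H,
          (∑ W ∈ shellIn π (S \ {v, π v}) (t' - 1) (c' - 1),
              (fun x : ℤ => ψ (x + 1) * (2 * lam * ((x + 1 : ℤ) : ℝ) + L)) ((W ∩ H).card : ℤ)) /
            ((shellIn π (S \ {v, π v}) (t' - 1) (c' - 1)).card : ℝ))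
      + (4 * lam * kap * cR + 4 * lam ^ 2) * (((c' : ℝ) / (S.card : ℝ)) * ∑ v ∈ S ∩ H,
          (∑ W ∈ shellIn π (S \ {v, π v}) (t' - 1) (c' - 1), (fun x : ℤ => ψ (x + 1)) ((W ∩ H).card : ℤ)) /
            ((shellIn π (S \ {v, π v}) (t' - 1) (c' - 1)).card : ℝ))
      + 4 * lam ^ 2 * ((((c' : ℝ) * ((c' : ℝ) - 1)) / ((S.card : ℝ) * ((S.card : ℝ) - 2))) *
          ∑ v ∈ S ∩ H, ∑ w ∈ (S ∩ H) \ {v, π v},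
            (∑ W ∈ shellIn π (del2 π S v w) (t' - 2) (c' - 2), (fun x : ℤ => ψ (x + 2)) ((W ∩ H).card : ℤ)) /
              ((shellIn π (del2 π S v w) (t' - 2) (c' - 2)).card : ℝ)) := by
  -- the three half-weighted averages, half-pinned
  have h1 := avg_halfCount_eq hπ hπ' hS H (by omega : 1 ≤ t') c' (fun x : ℤ => ψ x * (2 * lam * (x : ℝ) + L)) hne
  have h2 := avg_halfCount_eq hπ hπ' hS H (by omega : 1 ≤ t') c' ψ hne
  have h3 := avg_halfPairs_eq hπ hπ' hS H ht' c' ψ (fun h => hne (by omega))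
  simp only [Int.cast_add, Int.cast_one, Int.cast_natCast] at h1 h2 h3 ⊢
  rw [← h1, ← h2, ← h3]
  set K : ℝ := ((shellIn π S t' c').card : ℝ)
  simp only [div_eq_mul_inv]
  rw [show ∀ a b c d e f : ℝ, a * K⁻¹ - 2 * kap * cR * (b * K⁻¹) + kap ^ 2 * cR ^ 2 * (c * K⁻¹) - 4 * lam * (d * K⁻¹)
      + (4 * lam * kap * cR + 4 * lam ^ 2) * (e * K⁻¹) + 4 * lam ^ 2 * (f * K⁻¹) =
      (a - 2 * kap * cR * b + kap ^ 2 * cR ^ 2 * c - 4 * lam * d + (4 * lam * kap * cR + 4 * lam ^ 2) * e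
        + 4 * lam ^ 2 * f) * K⁻¹ from fun a b c d e f => by ring]
  congr 1
  simp only [mul_sum, ← sum_add_distrib, ← sum_sub_distrib]
  refine sum_congr rfl fun U _ => ?_
  ring

end Expand

/-! ### §6 The weighted level sum, expanded -/

section LevelSum

variable {π : Fin n → Fin n} (hπ : ∀ v, π (π v) = v) (hπ' : ∀ v, π v ≠ v)
include hπ hπ'

/-- **The weighted level sum of the tilted profile, expanded into seven polynomially weighted pieces.** For any rule
`(C, w)`, a weight `p` vanishing on the levels `c < g`, and nonempty shells at the levels `c ≥ g+1`:
`Σ_c w_c p(c)·E_{Shell_S(t',c−g)}[ψ(X)(2λ(X−Y)+L−κc)²] = Σ_c w_c p(c)E[ψ₀] − 2κΣ_c w_c (pX)(c)E[ψ₁] + κ²Σ_c w_c(pX²)(c)E[ψ]`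
`− (4λ/|S|)Σ_vΣ_c w_c (p(X−g))(c)E_v[ψ₁(·+1)] + (4λκ/|S|)Σ_vΣ_c w_c(pX(X−g))(c)E_v[ψ(·+1)] + (4λ²/|S|)Σ_vΣ_c w_c(p(X−g))(c)E_v[ψ(·+1)]`
`+ (4λ²/(|S|(|S|−2)))Σ_vΣ_wΣ_c w_c (p(X−g)(X−g−1))(c)E_{vw}[ψ(·+2)]`. [cite: Rothvoss2017, §2 (PDF p. 6)] -/
theorem levelSum_tilted_expand {S : Finset (Fin n)} (hS : ∀ u ∈ S, π u ∈ S) (H : Finset (Fin n)) {t' : ℕ}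
    (ht' : 2 ≤ t') (g : ℕ) (C : Finset ℕ) (w : ℕ → ℝ) (p : ℝ[X]) (hpC : ∀ c ∈ C, c < g → p.eval (c : ℝ) = 0)
    (hne : ∀ c ∈ C, g + 1 ≤ c → (shellIn π S t' (c - g)).Nonempty) (ψ : ℤ → ℝ) (lam kap L : ℝ) :
    ∑ c ∈ C, w c * (p.eval (c : ℝ) *
        ((∑ U ∈ shellIn π S t' (c - g), ψ ((U ∩ H).card : ℤ) *
            (2 * lam * (((U ∩ H).card : ℝ) - ((half π U ∩ H).card : ℝ)) + L - kap * c) ^ 2) /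
          ((shellIn π S t' (c - g)).card : ℝ))) =
      ∑ c ∈ C, w c * (p.eval (c : ℝ) *
          ((∑ U ∈ shellIn π S t' (c - g), (fun x : ℤ => ψ x * (2 * lam * (x : ℝ) + L) ^ 2) ((U ∩ H).card : ℤ)) /
            ((shellIn π S t' (c - g)).card : ℝ)))
      - 2 * kap * ∑ c ∈ C, w c * ((p * X).eval (c : ℝ) *
          ((∑ U ∈ shellIn π S t' (c - g), (fun x : ℤ => ψ x * (2 * lam * (x : ℝ) + L)) ((U ∩ H).card : ℤ)) /
            ((shellIn π S t' (c - g)).card : ℝ)))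
      + kap ^ 2 * ∑ c ∈ C, w c * ((p * X ^ 2).eval (c : ℝ) *
          ((∑ U ∈ shellIn π S t' (c - g), ψ ((U ∩ H).card : ℤ)) / ((shellIn π S t' (c - g)).card : ℝ)))
      - 4 * lam / (S.card : ℝ) * ∑ v ∈ S ∩ H, ∑ c ∈ C, w c * ((p * (X - Polynomial.C (g : ℝ))).eval (c : ℝ) *
          ((∑ W ∈ shellIn π (S \ {v, π v}) (t' - 1) (c - g - 1),
              (fun x : ℤ => ψ (x + 1) * (2 * lam * ((x + 1 : ℤ) : ℝ) + L)) ((W ∩ H).card : ℤ)) /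
            ((shellIn π (S \ {v, π v}) (t' - 1) (c - g - 1)).card : ℝ)))
      + 4 * lam * kap / (S.card : ℝ) * ∑ v ∈ S ∩ H, ∑ c ∈ C,
          w c * ((p * X * (X - Polynomial.C (g : ℝ))).eval (c : ℝ) *
          ((∑ W ∈ shellIn π (S \ {v, π v}) (t' - 1) (c - g - 1), (fun x : ℤ => ψ (x + 1)) ((W ∩ H).card : ℤ)) /
            ((shellIn π (S \ {v, π v}) (t' - 1) (c - g - 1)).card : ℝ)))
      + 4 * lam ^ 2 / (S.card : ℝ) * ∑ v ∈ S ∩ H, ∑ c ∈ C,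
          w c * ((p * (X - Polynomial.C (g : ℝ))).eval (c : ℝ) *
          ((∑ W ∈ shellIn π (S \ {v, π v}) (t' - 1) (c - g - 1), (fun x : ℤ => ψ (x + 1)) ((W ∩ H).card : ℤ)) /
            ((shellIn π (S \ {v, π v}) (t' - 1) (c - g - 1)).card : ℝ)))
      + 4 * lam ^ 2 / ((S.card : ℝ) * ((S.card : ℝ) - 2)) * ∑ v ∈ S ∩ H, ∑ w' ∈ (S ∩ H) \ {v, π v}, ∑ c ∈ C,
          w c * ((p * (X - Polynomial.C (g : ℝ)) * (X - Polynomial.C ((g : ℝ) + 1))).eval (c : ℝ) *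
          ((∑ W ∈ shellIn π (del2 π S v w') (t' - 2) (c - g - 2), (fun x : ℤ => ψ (x + 2)) ((W ∩ H).card : ℤ)) /
            ((shellIn π (del2 π S v w') (t' - 2) (c - g - 2)).card : ℝ))) := by
  -- per level
  have hlev : ∀ c ∈ C, w c * (p.eval (c : ℝ) *
        ((∑ U ∈ shellIn π S t' (c - g), ψ ((U ∩ H).card : ℤ) *
            (2 * lam * (((U ∩ H).card : ℝ) - ((half π U ∩ H).card : ℝ)) + L - kap * c) ^ 2) /
          ((shellIn π S t' (c - g)).card : ℝ))) =
      w c * (p.eval (c : ℝ) *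
          ((∑ U ∈ shellIn π S t' (c - g), (fun x : ℤ => ψ x * (2 * lam * (x : ℝ) + L) ^ 2) ((U ∩ H).card : ℤ)) /
            ((shellIn π S t' (c - g)).card : ℝ)))
      - 2 * kap * (w c * ((p * X).eval (c : ℝ) *
          ((∑ U ∈ shellIn π S t' (c - g), (fun x : ℤ => ψ x * (2 * lam * (x : ℝ) + L)) ((U ∩ H).card : ℤ)) /
            ((shellIn π S t' (c - g)).card : ℝ))))
      + kap ^ 2 * (w c * ((p * X ^ 2).eval (c : ℝ) *
          ((∑ U ∈ shellIn π S t' (c - g), ψ ((U ∩ H).card : ℤ)) / ((shellIn π S t' (c - g)).card : ℝ))))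
      - 4 * lam / (S.card : ℝ) * ∑ v ∈ S ∩ H, w c * ((p * (X - Polynomial.C (g : ℝ))).eval (c : ℝ) *
          ((∑ W ∈ shellIn π (S \ {v, π v}) (t' - 1) (c - g - 1),
              (fun x : ℤ => ψ (x + 1) * (2 * lam * ((x + 1 : ℤ) : ℝ) + L)) ((W ∩ H).card : ℤ)) /
            ((shellIn π (S \ {v, π v}) (t' - 1) (c - g - 1)).card : ℝ)))
      + 4 * lam * kap / (S.card : ℝ) * ∑ v ∈ S ∩ H,
          w c * ((p * X * (X - Polynomial.C (g : ℝ))).eval (c : ℝ) *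
          ((∑ W ∈ shellIn π (S \ {v, π v}) (t' - 1) (c - g - 1), (fun x : ℤ => ψ (x + 1)) ((W ∩ H).card : ℤ)) /
            ((shellIn π (S \ {v, π v}) (t' - 1) (c - g - 1)).card : ℝ)))
      + 4 * lam ^ 2 / (S.card : ℝ) * ∑ v ∈ S ∩ H,
          w c * ((p * (X - Polynomial.C (g : ℝ))).eval (c : ℝ) *
          ((∑ W ∈ shellIn π (S \ {v, π v}) (t' - 1) (c - g - 1), (fun x : ℤ => ψ (x + 1)) ((W ∩ H).card : ℤ)) /
            ((shellIn π (S \ {v, π v}) (t' - 1) (c - g - 1)).card : ℝ)))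
      + 4 * lam ^ 2 / ((S.card : ℝ) * ((S.card : ℝ) - 2)) * ∑ v ∈ S ∩ H, ∑ w' ∈ (S ∩ H) \ {v, π v},
          w c * ((p * (X - Polynomial.C (g : ℝ)) * (X - Polynomial.C ((g : ℝ) + 1))).eval (c : ℝ) *
          ((∑ W ∈ shellIn π (del2 π S v w') (t' - 2) (c - g - 2), (fun x : ℤ => ψ (x + 2)) ((W ∩ H).card : ℤ)) /
            ((shellIn π (del2 π S v w') (t' - 2) (c - g - 2)).card : ℝ))) := by
    intro c hc
    have hne' : 1 ≤ c - g → (shellIn π S t' (c - g)).Nonempty := fun h => hne c hc (by omega)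
    rw [avg_tilted_expand hπ hπ' hS H ht' (c - g) hne' ψ lam kap L (c : ℝ)]
    simp only [eval_mul, eval_X, eval_pow, eval_sub, eval_C, ← mul_sum]
    rcases le_or_gt g c with hgc | hgc
    · rw [Nat.cast_sub hgc]
      ring
    · rw [hpC c hc hgc]
      ring
  rw [sum_congr rfl hlev]
  exact sum_regroup7 C (S ∩ H) (fun v => (S ∩ H) \ {v, π v}) _ _ _ _ _ _ _ _ _ _ _ _ _

end LevelSum

/-! ### §7 Small tools for the assembly -/

section Main

variable {π : Fin n → Fin n} (hπ : ∀ v, π (π v) = v) (hπ' : ∀ v, π v ≠ v)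
include hπ hπ'

omit hπ hπ' in
/-- Auxiliary count: in a stable ground set without `HH` edge, `|S∩H|·(|S∩H|−1) ≤ (|S|−1)(|S|−2)`.
[cite: Rothvoss2017, §2 (PDF p. 5)] -/
theorem card_inter_mul_pred_le {S : Finset (Fin n)} (hS : ∀ v ∈ S, π v ∈ S) (H : Finset (Fin n))
    (hno : ∀ v ∈ S, ¬ (v ∈ H ∧ π v ∈ H)) (h2 : 2 ≤ S.card) :
    (S ∩ H).card * ((S ∩ H).card - 1) ≤ (S.card - 1) * (S.card - 2) := by
  rcases (S ∩ H).eq_empty_or_nonempty with h | ⟨v, hv⟩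
  · rw [h, card_empty]; simp
  · have h1 := card_inter_succ_le (π := π) hS H hno hv
    exact Nat.mul_le_mul (by omega) (by omega)

omit hπ hπ' in
/-- Averaging a bounded family against a prefactor `k/S_c` with `|V| ≤ S_c`: `|k/S_c·Σ_{v∈V} f(v)| ≤ k₀·B`.
[cite: Rothvoss2017, §2 (PDF p. 6)] -/
theorem abs_div_mul_sum_le {κ : Type*} (V : Finset κ) (f : κ → ℝ) {B : ℝ} (hB : 0 ≤ B)
    (hf : ∀ v ∈ V, |f v| ≤ B) {Sc k k₀ : ℝ} (hSc : 0 < Sc) (hV : (V.card : ℝ) ≤ Sc) (hk : |k| ≤ k₀) :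
    |k / Sc * ∑ v ∈ V, f v| ≤ k₀ * B := by
  rw [abs_mul, abs_div, abs_of_pos hSc]
  have h1 : |∑ v ∈ V, f v| ≤ (V.card : ℝ) * B :=
    (abs_sum_le_sum_abs _ _).trans ((sum_le_sum hf).trans (by rw [sum_const, nsmul_eq_mul]))
  have hk0 : 0 ≤ k₀ := (abs_nonneg _).trans hk
  calc |k| / Sc * |∑ v ∈ V, f v| ≤ k₀ / Sc * ((V.card : ℝ) * B) :=
        mul_le_mul (div_le_div_of_nonneg_right hk hSc.le) h1 (abs_nonneg _) (by positivity)
    _ = k₀ * B * ((V.card : ℝ) / Sc) := by field_simp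
    _ ≤ k₀ * B * 1 := mul_le_mul_of_nonneg_left ((div_le_one hSc).2 hV) (by positivity)
    _ = k₀ * B := mul_one _

omit hπ hπ' in
/-- The double-sum version of `abs_div_mul_sum_le`: `|k/D₀·Σ_vΣ_{w∈W_v} f(v,w)| ≤ k₀·B` when `Σ_v |W_v| ≤ D₀`.
[cite: Rothvoss2017, §2 (PDF p. 6)] -/
theorem abs_div_mul_sum_sum_le {κ : Type*} (V : Finset κ) (Wv : κ → Finset κ) (f : κ → κ → ℝ) {B : ℝ} (hB : 0 ≤ B)
    (hf : ∀ v ∈ V, ∀ w ∈ Wv v, |f v w| ≤ B) {D₀ k k₀ : ℝ} (hD : 0 < D₀)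
    (hV : (∑ v ∈ V, ((Wv v).card : ℝ)) ≤ D₀) (hk : |k| ≤ k₀) :
    |k / D₀ * ∑ v ∈ V, ∑ w ∈ Wv v, f v w| ≤ k₀ * B := by
  rw [abs_mul, abs_div, abs_of_pos hD]
  have h1 : |∑ v ∈ V, ∑ w ∈ Wv v, f v w| ≤ (∑ v ∈ V, ((Wv v).card : ℝ)) * B := by
    refine (abs_sum_le_sum_abs _ _).trans ?_
    rw [sum_mul]
    refine sum_le_sum fun v hv => (abs_sum_le_sum_abs _ _).trans ((sum_le_sum (hf v hv)).trans ?_)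
    rw [sum_const, nsmul_eq_mul]
  have hk0 : 0 ≤ k₀ := (abs_nonneg _).trans hk
  have hW0 : 0 ≤ ∑ v ∈ V, ((Wv v).card : ℝ) := sum_nonneg fun v _ => Nat.cast_nonneg _
  calc |k| / D₀ * |∑ v ∈ V, ∑ w ∈ Wv v, f v w| ≤ k₀ / D₀ * ((∑ v ∈ V, ((Wv v).card : ℝ)) * B) :=
        mul_le_mul (div_le_div_of_nonneg_right hk hD.le) h1 (abs_nonneg _) (by positivity)
    _ = k₀ * B * ((∑ v ∈ V, ((Wv v).card : ℝ)) / D₀) := by field_simp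
    _ ≤ k₀ * B * 1 := mul_le_mul_of_nonneg_left ((div_le_one hD).2 hV) (by positivity)
    _ = k₀ * B := mul_one _

omit hπ hπ' in
/-- Degrees of the five derived level weights `pX`, `pX²`, `p(X−a)`, `pX(X−a)`, `p(X−a)(X−b)`.
[cite: Agarwal2000DifferenceEquations, Remark 1.8.1 (1.8.8)] -/
theorem weights_natDegree_le (p : ℝ[X]) (a b' : ℝ) {D D' : ℕ} (h : p.natDegree + 2 + D' ≤ D) :
    (p * X).natDegree + D' ≤ D ∧ (p * X ^ 2).natDegree + D' ≤ D ∧ (p * (X - Polynomial.C a)).natDegree + D' ≤ D ∧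
      (p * X * (X - Polynomial.C a)).natDegree + D' ≤ D ∧
      (p * (X - Polynomial.C a) * (X - Polynomial.C b')).natDegree + D' ≤ D := by
  have h1 := natDegree_mul_le (p := p) (q := (X : ℝ[X])); rw [natDegree_X] at h1
  have h2 := natDegree_mul_le (p := p) (q := (X ^ 2 : ℝ[X])); rw [natDegree_X_pow] at h2
  have h3 := natDegree_mul_le (p := p) (q := (X - Polynomial.C a)); rw [natDegree_X_sub_C] at h3
  have h4 := natDegree_mul_le (p := p * X) (q := (X - Polynomial.C a)); rw [natDegree_X_sub_C] at h4
  have h5 := natDegree_mul_le (p := p * (X - Polynomial.C a)) (q := (X - Polynomial.C b'))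
  rw [natDegree_X_sub_C] at h5
  refine ⟨?_, ?_, ?_, ?_, ?_⟩ <;> omega

omit hπ hπ' in
/-- Sizes of the five derived level weights on levels `3 ≤ c ≤ T` when `0 ≤ a ≤ T`, `|p(c)| ≤ P`:
`|pc| ≤ PT`, `|pc²| ≤ PT²`, `|p(c−a)| ≤ PT`, `|pc(c−a)| ≤ PT²`, `|p(c−a)(c−a−1)| ≤ PT²`.
[cite: Agarwal2000DifferenceEquations, Remark 1.8.1 (1.8.8)] -/
theorem weights_abs_eval_le (p : ℝ[X]) (C : Finset ℕ) {P : ℝ} (hP : ∀ c ∈ C, |p.eval (c : ℝ)| ≤ P) (hP0 : 0 ≤ P)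
    {a T : ℝ} (ha0 : 0 ≤ a) (haT : a ≤ T) (hC : ∀ c ∈ C, (3 : ℝ) ≤ c ∧ (c : ℝ) ≤ T) :
    (∀ c ∈ C, |(p * X).eval (c : ℝ)| ≤ P * T) ∧ (∀ c ∈ C, |(p * X ^ 2).eval (c : ℝ)| ≤ P * T ^ 2) ∧
      (∀ c ∈ C, |(p * (X - Polynomial.C a)).eval (c : ℝ)| ≤ P * T) ∧
      (∀ c ∈ C, |(p * X * (X - Polynomial.C a)).eval (c : ℝ)| ≤ P * T ^ 2) ∧
      (∀ c ∈ C, |(p * (X - Polynomial.C a) * (X - Polynomial.C (a + 1))).eval (c : ℝ)| ≤ P * T ^ 2) := by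
  have hcT : ∀ c ∈ C, (0 : ℝ) ≤ c ∧ (c : ℝ) ≤ T ∧ |(c : ℝ) - a| ≤ T ∧ |(c : ℝ) - (a + 1)| ≤ T := by
    intro c hc
    obtain ⟨h3, hcT⟩ := hC c hc
    refine ⟨by linarith, hcT, abs_le.2 ⟨by linarith, by linarith⟩, abs_le.2 ⟨by linarith, by linarith⟩⟩
  have hT0 : 0 ≤ T := ha0.trans haT
  have hPT : 0 ≤ P * T := mul_nonneg hP0 hT0
  refine ⟨fun c hc => ?_, fun c hc => ?_, fun c hc => ?_, fun c hc => ?_, fun c hc => ?_⟩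
  · obtain ⟨h0c, hcT', _⟩ := hcT c hc
    rw [eval_mul, eval_X, abs_mul, abs_of_nonneg h0c]
    exact mul_le_mul (hP c hc) hcT' h0c hP0
  · obtain ⟨h0c, hcT', _⟩ := hcT c hc
    rw [eval_mul, eval_pow, eval_X, abs_mul, abs_pow, abs_of_nonneg h0c]
    exact mul_le_mul (hP c hc) (pow_le_pow_left₀ h0c hcT' 2) (sq_nonneg _) hP0
  · obtain ⟨_, _, hcg, _⟩ := hcT c hc
    rw [eval_mul, eval_sub, eval_X, eval_C, abs_mul]
    exact mul_le_mul (hP c hc) hcg (abs_nonneg _) hP0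
  · obtain ⟨h0c, hcT', hcg, _⟩ := hcT c hc
    rw [eval_mul, eval_mul, eval_sub, eval_X, eval_C, abs_mul, abs_mul, abs_of_nonneg h0c, sq, ← mul_assoc]
    exact mul_le_mul (mul_le_mul (hP c hc) hcT' h0c hP0) hcg (abs_nonneg _) hPT
  · obtain ⟨_, _, hcg, hcg1⟩ := hcT c hc
    rw [eval_mul, eval_mul, eval_sub, eval_sub, eval_X, eval_C, eval_C, abs_mul, abs_mul, sq, ← mul_assoc]
    exact mul_le_mul (mul_le_mul (hP c hc) hcg (abs_nonneg _) hP0) hcg1 (abs_nonneg _) hPT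

end Main

end Summit.PneNP.PneNP.Theorems.ChebyshevTracialDesignTiltedSmallBlockExpansion

end
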